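import Summits.HubbardSuperconductivity.HubbardSuperconductivity.Theorems.AnisotropyChordTransferFibre3FinXDCheck

/-!
# Route `AnisotropyChord` / H0 rotor rung: FIN per-`L` row-D (KT-2a″) SUB-CELL facts, `L = 10` (48–53)

Row-D facts `xdCellAny0 10 (49/50) la lb aD = true` on quarter sub-cells of the combined cells whose side condition needs `aD ≈ .04` (mechhunt STATUS p3 g7 REPORT 3).
Prover seat `hubbard-h0-rotor-p3` g7; helper for piece A = stmt-HubbardSuperconductivity-23918 of rung 19089 (`--supports`, helper class).
WHAT THIS IS NOT: nothing here proves superconductivity in the Hubbard model (rotor TARGET as worded stays FALSE, g15 verdict); kernel facts /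
assembly for ONE conditional reduction at one `L`.  No sorry.
-/

set_option linter.dupNamespace false
set_option autoImplicit false

namespace Summit.HubbardSuperconductivity.HubbardSuperconductivity.Theorems.AnisotropyChord.Transfer.Fibre3

namespace FinXD

/-- row-D sub-cell `[18660066116779837, 18776691530009711]` of `L = 10`. [folklore] -/
theorem xd10s_141_0 : xdCellAny0 10 (49/50 : ℚ) 18660066116779837 18776691530009711 (1/25 : ℚ) = true := by decide +kernel

/-- row-D sub-cell `[18776691530009711, 18893316943239585]` of `L = 10`. [folklore] -/
theorem xd10s_141_1 : xdCellAny0 10 (49/50 : ℚ) 18776691530009711 18893316943239585 (1/25 : ℚ) = true := by decide +kernel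

/-- row-D sub-cell `[18893316943239585, 19009942356469459]` of `L = 10`. [folklore] -/
theorem xd10s_141_2 : xdCellAny0 10 (49/50 : ℚ) 18893316943239585 19009942356469459 (1/25 : ℚ) = true := by decide +kernel

/-- row-D sub-cell `[19009942356469459, 19126567769699333]` of `L = 10`. [folklore] -/
theorem xd10s_141_3 : xdCellAny0 10 (49/50 : ℚ) 19009942356469459 19126567769699333 (1/25 : ℚ) = true := by decide +kernel

/-- row-D sub-cell `[19126567769699333, 19246108818259953]` of `L = 10`. [folklore] -/
theorem xd10s_142_0 : xdCellAny0 10 (49/50 : ℚ) 19126567769699333 19246108818259953 (1/25 : ℚ) = true := by decide +kernel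

/-- row-D sub-cell `[19246108818259953, 19365649866820573]` of `L = 10`. [folklore] -/
theorem xd10s_142_1 : xdCellAny0 10 (49/50 : ℚ) 19246108818259953 19365649866820573 (1/25 : ℚ) = true := by decide +kernel

end FinXD

end Summit.HubbardSuperconductivity.HubbardSuperconductivity.Theorems.AnisotropyChord.Transfer.Fibre3
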